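import Literature.NumberTheory.LFunctions.MertensCertificate
import Literature.NumberTheory.LFunctions.LiouvilleKernelTheorem
import HarnessLib

/-!
# The certified computation behind Haselgrove's disproof of the conjectures of Pólya and Turán

Trunk T-ANT (NumberTheory/LFunctions). This file defines the executable *checkers* whose
acceptance (evaluated by `native_decide` in the block files `LiouvilleCertificate/Chunk*.lean`,
`LiouvilleCertificate/Final.lean`) proves the numerical hypotheses of the theorems
`frequently_liouvilleSum_natCast_pos_of_polyaKernelSum_pos`,
`frequently_liouvilleHarmonicSum_natCast_neg_of_turanKernelSum_neg` (`LiouvilleKernelTheorem.lean`): with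
`T = 2516` (the height of the 2000 certified zero brackets `ZetaNumerics.Mertens.ordinates` and of
the zero count `N(2516) = 2000` of the tree's Odlyzko–te Riele certificate,
`MertensCertificate.lean`), the Jurkat–Peyerimhoff kernel `k(t) = g(t/T₁)` at Haselgrove's height
`T₁ = 1000` ("This computation employed the first 649 zeros of the Riemann zeta function",
Borwein–Ferguson–Mossinghoff 2008, p. 1683) and the points `y_L = 831.84844`, `y_T = 996.98037`
(Haselgrove: `831.847` and `996.980`, BFM pp. 1683–1684),

* `Re A*(y_L) > 0`, `A*(y) = 1/ζ(½) + Σ_{|γ|<T} k(γ) e^{iγy} ζ(2ρ)/(ρζ'(ρ))` (BFM (4); `≈ 0.0183`),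
* `Re B*(y_T) < 0`, `B*(y) = -1/ζ(½) + Σ_{|γ|<T} k(γ) e^{iγy} ζ(2ρ)/((ρ-1)ζ'(ρ))` (BFM (7); `≈ -0.0627`),

and proves their **soundness** (`numerics_of_checks`). The zeros (brackets, twisted sign tests,
top-edge winding count) are those certified by the Mertens block files, imported as hypotheses
`checkChunk k = true`, `checkTop = true`; the new arithmetic per zero is one more certified
evaluation of `ζ` (at `1 + 2iγ`, for `ζ(2ρ)`) and the two summands, with the evaluator `zetaBox`
(`ZetaCertifiedEvaluation.lean`) and the tables `tablesZ` (scale `2^330`, `N = 1000`, `ν = 150`) of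
the Mertens certificate; one evaluation at `s = ½` encloses `1/ζ(½) = -0.6847…`.

## The data (verified, never trusted)

* `yLNum / 10⁶ = 831.84844`, `yTNum / 10⁶ = 996.98037`;
* `chunkBounds[k] = (L_k, U_k)`, `k < 7`: claimed `L_k 2^{-60} ≤ Σ_{block k} termP y_L γ_j` and
  `Σ_{block k} termT y_T γ_j ≤ U_k 2^{-60}` over the blocks `j = 100k, …` of the first 649 zeros
  (computed externally in floating point with a margin `10⁻⁷` per block).

## The checks

* `checkChunk k` (`k < 7`): for the zeros of block `k`: enclosures of the summands
  `termP y_L γ = 2 Re [k(γ) e^{iγy_L} ζ(2ρ)/(ρζ'(ρ))]`, `termT y_T γ = 2 Re [k(γ) e^{iγy_T} ζ(2ρ)/((ρ-1)ζ'(ρ))]`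
  valid for every `γ` in the bracket (`ζ'(ρ)` from the slope as in the Mertens certificate,
  `norm_deriv_riemannZeta_sub_slope_le`), summed and compared with `chunkBounds[k]`.
* `checkFinal`: the bracket range (`t₂(648) ≤ 1000 ≤ t₁(649)`: exactly the first 649 zeros have
  `γ < T₁`), an enclosure `[ilo, ihi]` of `Re (1/ζ(½))`, and `ilo + Σ L_k > 0`, `Σ U_k < ilo`
  (scales adjusted).

## Main result

* `numerics_of_checks : (∀ k < 20, Mertens.checkChunk k) → Mertens.checkTop → (∀ k < 7, checkChunk k)
  → checkFinal → (zeros below 2516 simple and on the line) ∧ Re A*(y_L) > 0 ∧ Re B*(y_T) < 0`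
  (kernel `kL = g(·/1000)`, height `2516`).

## References

* C. B. Haselgrove, *A disproof of a conjecture of Pólya*, Mathematika 5 (1958), 141–145.
  [HaselgroveMathematika1958]
* P. Borwein, R. Ferguson, M. J. Mossinghoff, *Sign changes in sums of the Liouville function*,
  Math. Comp. 77 (2008), 1681–1694, §1 (4)–(7) pp. 1683–1684. [BorweinFergusonMossinghoff2008]
* A. M. Odlyzko, H. J. J. te Riele, *Disproof of the Mertens conjecture*, J. reine angew. Math.
  357 (1985), §4.1 (4.1) (the kernel). [OdlyzkoTeRiele1985]
-/

open Finset Complex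
open Literature.Analysis.ValidatedNumerics.NumericsMP Literature.NumberTheory.LFunctions.ZetaNumerics
  Literature.NumberTheory.LFunctions Literature.NumberTheory.LFunctions.MertensZeroCertificate
open Literature.NumberTheory.LFunctions.ZetaNumerics.Mertens (SZ tablesZ halfZ ordinate t₁ t₂ rSlope
  CHUNK NCHUNK NZ heightT0 yDen orderOk SZ_pos SZ_eq heightT0_pos heightT0_real yDen_pos
  tablesZ_valid tablesZ_S mem_inputBox mem_bracket orderOk_sound checkChunk_sound
  zetaZeroCount_of_checkTop sum_range_mul)

namespace Literature.NumberTheory.LFunctions.ZetaNumerics.Liouville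

/-! ## Data and parameters -/

/-- Haselgrove's height `m = 1000` (here the support `T₁` of the Jurkat–Peyerimhoff transform).
[cite: BorweinFergusonMossinghoff2008, §1 p. 1683] -/
def heightT1 : ℕ := 1000

/-- The number of zeros with `0 < γ < 1000`: 649 ("the first 649 zeros", BFM p. 1683). [cite: BorweinFergusonMossinghoff2008, §1 p. 1683] -/
def NZL : ℕ := 649

/-- Number of blocks. [folklore] -/
def NCHUNKL : ℕ := 7

/-- `y_L · 10⁶`, `y_L = 831.84844` (Haselgrove: `y = 831.847`, `A*_{1000}(y) ≈ .00495`).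
[cite: BorweinFergusonMossinghoff2008, §1 p. 1683] -/
def yLNum : ℤ := 831848440

/-- `y_T · 10⁶`, `y_T = 996.98037` (Haselgrove: `y = 996.980` "produces a negative value of `B*_m(y)`").
[cite: BorweinFergusonMossinghoff2008, §1 p. 1684] -/
def yTNum : ℤ := 996980370

/-- The claimed block bounds `(L_k, U_k)` at scale `2^60`, `k = 0, …, 6` (blocks of 100 zeros, the
last of 49). [cite: BorweinFergusonMossinghoff2008, §1 pp. 1683–1684] -/
def chunkBounds : Array (ℤ × ℤ) := #[
  (789545564161994368, -874892660634695680),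
  (19081860931445652, 18751442827296328),
  (3960394328503703, -2032026824575795),
  (-1306625914686657, -4185861866695521),
  (-626303732592733, 515442771938303),
  (-81146433451949, 38207860768466),
  (5922875345998, -3562251103330)]

/-- The length of block `k`: `100, …, 100, 49`. [folklore] -/
def chunkLen (k : ℕ) : ℕ := min CHUNK (NZL - k * CHUNK)

/-- `y_L`. [cite: BorweinFergusonMossinghoff2008, §1 p. 1683] -/
noncomputable def yL : ℝ := (yLNum : ℝ) / yDen

/-- `y_T`. [cite: BorweinFergusonMossinghoff2008, §1 p. 1684] -/
noncomputable def yT : ℝ := (yTNum : ℝ) / yDen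

/-- The kernel transform `k(t) = g(t/T₁)`, `T₁ = 1000`. [cite: OdlyzkoTeRiele1985, §4.1 (4.1) p. 150] -/
noncomputable def kL (t : ℝ) : ℂ := (jurkatPeyerimhoffKernel (t / heightT1) : ℂ)

/-- The summand of `Re A*`: `2 Re [k(γ) e^{iγy} ζ(2ρ)/(ρ ζ'(ρ))]`, `ρ = ½ + iγ`. [cite: BorweinFergusonMossinghoff2008, §1 (4) p. 1683] -/
noncomputable def termP (y γ : ℝ) : ℝ :=
  2 * (kL γ * cexp (I * (γ * y)) *
    (riemannZeta (2 * (1 / 2 + γ * I)) / ((1 / 2 + γ * I) * deriv riemannZeta (1 / 2 + γ * I)))).re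

/-- The summand of `Re B*`: `2 Re [k(γ) e^{iγy} ζ(2ρ)/((ρ-1) ζ'(ρ))]`. [cite: BorweinFergusonMossinghoff2008, §1 (7) p. 1684] -/
noncomputable def termT (y γ : ℝ) : ℝ :=
  2 * (kL γ * cexp (I * (γ * y)) *
    (riemannZeta (2 * (1 / 2 + γ * I)) / ((1 / 2 + γ * I - 1) * deriv riemannZeta (1 / 2 + γ * I)))).re

/-! ## The checkers -/

/-- Enclosure of `g(u)`, `u = γ/T₁`, for `γ` in the interval `G` (`0 ≤ u ≤ 1`):
`g(u) = (1 − u) cos(πu) + sin(πu)/π` (as `Mertens.kernelBox`, with `T₁` for `T₀`). [cite: OdlyzkoTeRiele1985, §4.1 (4.1) p. 150] -/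
def kernelBoxL (T : Tables) (G : MI) : Option MI :=
  let U := G.divNat heightT1
  match MC.expI SZ T.KI T.kI T.piI (MI.mul SZ U T.piI) with
  | none => none
  | some E =>
    match MI.divPos SZ E.im T.piI with
    | none => none
    | some sdiv => some ((MI.mul SZ ((MI.ofInt SZ 1).sub U) E.re).add sdiv)

/-- Enclosure of `2 Re [e^{iγy} g ZZ / Den]` for `γ ∈ G`, `y = yNum/yDen`. [folklore] -/
def termBoxZ (T : Tables) (G g : MI) (ZZ Den : MC) (yNum : ℤ) : Option MI :=
  match MC.expI SZ T.KI T.kI T.piI ((G.mulInt yNum).divNat yDen) with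
  | none => none
  | some E2 =>
    match MC.divBox SZ (MC.mul SZ (E2.mulMI SZ g) ZZ) Den with
    | none => none
    | some F => some (F.re.mulInt 2)

/-- The per-zero computation: from the bracket integer `a`, the values `ζ(½+it₁)`, `ζ(½+it₂)`
(for the slope enclosing `ζ'(ρ)`), `ζ(1 + 2iγ)` on the whole bracket, and the bounds
`(lo of termP at y_L, hi of termT at y_T)` scaled by `SZ`. [folklore] -/
def zeroTerm (T : Tables) (a : ℤ) : Option (ℤ × ℤ) :=
  let G : MI := ⟨a * 2 ^ 90, (a + 1) * 2 ^ 90⟩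
  match zetaBox T ⟨halfZ, MI.ofScaled (a * 2 ^ 90)⟩,
    zetaBox T ⟨halfZ, MI.ofScaled ((a + 1) * 2 ^ 90)⟩,
    zetaBox T ⟨MI.ofInt SZ 1, ⟨a * 2 ^ 91, (a + 1) * 2 ^ 91⟩⟩ with
  | some Z1, some Z2, some ZZ =>
    let D := (MC.mulNegI ((Z2.sub Z1).mulInt (2 ^ 240))).widen rSlope
    let DenL := MC.mul SZ ⟨halfZ, G⟩ D
    let DenT := MC.mul SZ ⟨halfZ.sub (MI.ofInt SZ 1), G⟩ D
    match kernelBoxL T G with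
    | none => none
    | some g =>
      match termBoxZ T G g ZZ DenL yLNum, termBoxZ T G g ZZ DenT yTNum with
      | some FL, some FT => some (FL.lo, FT.hi)
      | _, _ => none
  | _, _, _ => none

/-- Accumulated sums `(Σ lo, Σ hi)` over the first `i` zeros of block `k`, `none` on any failure.
[folklore] -/
def chunkSums (T : Tables) (k : ℕ) : ℕ → Option (ℤ × ℤ)
  | 0 => some (0, 0)
  | i + 1 =>
    match chunkSums T k i with
    | none => none
    | some (sl, sh) =>
      match zeroTerm T (ordinate (k * CHUNK + i)) with
      | some (vlo, vhi) => some (sl + vlo, sh + vhi)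
      | none => none

/-- Comparison of the accumulated sums of block `k` with the claimed bounds `(L_k, U_k)`
(scaled from `2^60` to `SZ = 2^330`). [folklore] -/
def boundsOk (k : ℕ) : Option (ℤ × ℤ) → Bool
  | none => false
  | some (sl, sh) =>
    decide ((chunkBounds.getD k (0, 0)).1 * 2 ^ 270 ≤ sl ∧ sh ≤ (chunkBounds.getD k (0, 0)).2 * 2 ^ 270)

/-- Block check `k` with given tables. [folklore] -/
def checkChunkWith (T : Tables) (k : ℕ) : Bool := boundsOk k (chunkSums T k (chunkLen k))

/-- **Block check `k`**. (Made irreducible at the end of this file.) [folklore] -/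
def checkChunk (k : ℕ) : Bool := (tablesZ.map fun T ↦ checkChunkWith T k).getD false

/-- The sum of the claimed lower bounds `L_k`. [folklore] -/
def sumL : ℤ := ∑ k ∈ Finset.range NCHUNKL, (chunkBounds.getD k (0, 0)).1

/-- The sum of the claimed upper bounds `U_k`. [folklore] -/
def sumU : ℤ := ∑ k ∈ Finset.range NCHUNKL, (chunkBounds.getD k (0, 0)).2

/-- The bracket range: `t₂(648) ≤ T₁ ≤ t₁(649)`, so that exactly the first 649 certified zeros have
`γ < T₁ = 1000`. [cite: BorweinFergusonMossinghoff2008, §1 p. 1683] -/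
def rangeOk : Bool :=
  decide (ordinate (NZL - 1) + 1 ≤ (heightT1 : ℤ) * 2 ^ 240 ∧ (heightT1 : ℤ) * 2 ^ 240 ≤ ordinate NZL)

/-- Final check with given tables: `rangeOk`, an enclosure of `Re (1/ζ(½))` with lower end `ilo`
(scale `SZ`), and `0 < ilo + Σ L_k 2^270`, `Σ U_k 2^270 < ilo`. [folklore] -/
def checkFinalWith (T : Tables) : Bool :=
  match zetaBox T ⟨halfZ, MI.ofInt SZ 0⟩ with
  | none => false
  | some ZH =>
    match MC.divBox SZ (MC.ofInt SZ 1) ZH with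
    | none => false
    | some IZ => rangeOk && decide (0 < IZ.re.lo + sumL * 2 ^ 270 ∧ sumU * 2 ^ 270 < IZ.re.lo)

/-- **Final check**. (Made irreducible at the end of this file.) [folklore] -/
def checkFinal : Bool := (tablesZ.map checkFinalWith).getD false

/-! ## Soundness -/

section Soundness

/-- [folklore] -/
lemma heightT1_pos : 0 < heightT1 := by unfold heightT1; norm_num
/-- [folklore] -/
lemma heightT1_real : (heightT1 : ℝ) = 1000 := by unfold heightT1; norm_num

/-! ### The kernel and the summands -/

/-- Soundness of `kernelBoxL`. [cite: OdlyzkoTeRiele1985, §4.1 (4.1) p. 150] -/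
theorem mem_kernelBoxL {T : Tables} (hT : T.Valid) (hTS : T.S = SZ) {G g : MI}
    (h : kernelBoxL T G = some g) {γ : ℝ} (hγ : MI.mem SZ γ G) (h0 : 0 ≤ γ)
    (h1 : γ ≤ heightT1) : MI.mem SZ (jurkatPeyerimhoffKernel (γ / heightT1)) g := by
  have hpi : MI.mem SZ Real.pi T.piI := hTS ▸ hT.mem_pi
  unfold kernelBoxL at h
  simp only at h
  split at h
  · simp at h
  · rename_i E hE
    split at h
    · simp at h
    · rename_i sdiv hsdiv
      simp only [Option.some.injEq] at h
      subst h
      set u : ℝ := γ / heightT1 with hu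
      have hU : MI.mem SZ u (G.divNat heightT1) := MI.mem_divNat hγ heightT1_pos
      have hΦ : MI.mem SZ (u * Real.pi) (MI.mul SZ (G.divNat heightT1) T.piI) :=
        MI.mem_mul SZ_pos hU hpi
      have hEm := MC.mem_expI SZ_pos hpi hE hΦ
      have hcos : MI.mem SZ (Real.cos (u * Real.pi)) E.re := by
        have := hEm.1; rwa [Complex.exp_ofReal_mul_I_re] at this
      have hsin : MI.mem SZ (Real.sin (u * Real.pi)) E.im := by
        have := hEm.2; rwa [Complex.exp_ofReal_mul_I_im] at this
      have hdiv := MI.mem_divPos SZ_pos hsdiv hsin hpi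
      have hone : MI.mem SZ (1 - u) ((MI.ofInt SZ 1).sub (G.divNat heightT1)) := by
        have := MI.mem_sub (MI.mem_ofInt SZ 1) hU; simpa using this
      have hres := MI.mem_add (MI.mem_mul SZ_pos hone hcos) hdiv
      have hu0 : 0 ≤ u := div_nonneg h0 (by positivity)
      have hu1 : u ≤ 1 := by
        rw [hu, div_le_one (by exact_mod_cast heightT1_pos)]; exact h1
      have hval : jurkatPeyerimhoffKernel u =
          (1 - u) * Real.cos (u * Real.pi) + Real.sin (u * Real.pi) / Real.pi := by
        unfold jurkatPeyerimhoffKernel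
        rw [abs_of_nonneg hu0, if_pos hu1, mul_comm Real.pi u]
        ring
      rw [hval]
      exact hres

/-- Soundness of `termBoxZ`: for `γ ∈ G`, `gv ∈ g`, `zz ∈ ZZ`, `w ∈ Den`,
`2 Re [e^{iγy} gv zz / w] ∈ termBoxZ` (`y = yNum / yDen`). [folklore] -/
theorem mem_termBoxZ {T : Tables} (hT : T.Valid) (hTS : T.S = SZ) {G g : MI} {ZZ Den : MC}
    {yNum : ℤ} {F : MI} (h : termBoxZ T G g ZZ Den yNum = some F) {γ : ℝ} (hγ : MI.mem SZ γ G)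
    {gv : ℝ} (hg : MI.mem SZ gv g) {zz : ℂ} (hzz : MC.mem SZ zz ZZ) {w : ℂ} (hw : MC.mem SZ w Den) :
    MI.mem SZ ((cexp (((γ * ((yNum : ℝ) / yDen) : ℝ) : ℂ) * I) * (gv : ℂ) * zz / w).re * 2) F := by
  have hpi : MI.mem SZ Real.pi T.piI := hTS ▸ hT.mem_pi
  unfold termBoxZ at h
  split at h
  · simp at h
  · rename_i E2 hE2
    split at h
    · simp at h
    · rename_i F' hF'
      simp only [Option.some.injEq] at h
      subst h
      have hΘ : MI.mem SZ (γ * ((yNum : ℝ) / yDen)) ((G.mulInt yNum).divNat yDen) := by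
        have := MI.mem_divNat (MI.mem_mulInt hγ yNum) yDen_pos
        convert this using 1; ring
      have hE := MC.mem_expI SZ_pos hpi hE2 hΘ
      have hP := MC.mem_mul SZ_pos (MC.mem_mulMI SZ_pos hE hg) hzz
      have hF := MC.mem_divBox SZ_pos hF' hP hw
      exact MI.mem_mulInt hF.1 2

/-- `termP` in the form produced by the checker. [folklore] -/
lemma termP_eq (y γ : ℝ) :
    termP y γ = (cexp (((γ * y : ℝ) : ℂ) * I) * (jurkatPeyerimhoffKernel (γ / heightT1) : ℂ) *
      riemannZeta (1 + (2 * γ) * I) / ((1 / 2 + γ * I) * deriv riemannZeta (1 / 2 + γ * I))).re * 2 := by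
  unfold termP kL
  rw [mul_comm (2 : ℝ)]
  congr 2
  have e1 : (2 : ℂ) * (1 / 2 + γ * I) = 1 + (2 * γ) * I := by ring
  rw [e1, show I * ((γ : ℂ) * (y : ℂ)) = ((γ * y : ℝ) : ℂ) * I by push_cast; ring]
  ring

/-- `termT` in the form produced by the checker. [folklore] -/
lemma termT_eq (y γ : ℝ) :
    termT y γ = (cexp (((γ * y : ℝ) : ℂ) * I) * (jurkatPeyerimhoffKernel (γ / heightT1) : ℂ) *
      riemannZeta (1 + (2 * γ) * I) / ((1 / 2 - 1 + γ * I) * deriv riemannZeta (1 / 2 + γ * I))).re * 2 := by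
  unfold termT kL
  rw [mul_comm (2 : ℝ)]
  congr 2
  have e1 : (2 : ℂ) * (1 / 2 + γ * I) = 1 + (2 * γ) * I := by ring
  have e2 : (1 / 2 : ℂ) + γ * I - 1 = 1 / 2 - 1 + γ * I := by ring
  rw [e1, e2, show I * ((γ : ℂ) * (y : ℂ)) = ((γ * y : ℝ) : ℂ) * I by push_cast; ring]
  ring

/-! ### One zero -/

/-- Membership of `1 + 2iγ` in the third input box. [folklore] -/
lemma mem_inputBox2 {a : ℤ} {γ : ℝ} (hγ : γ ∈ Set.Icc ((a : ℝ) / 2 ^ 240) (((a : ℝ) + 1) / 2 ^ 240)) :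
    MC.mem SZ (1 + ((2 * γ : ℝ) : ℂ) * I) ⟨MI.ofInt SZ 1, ⟨a * 2 ^ 91, (a + 1) * 2 ^ 91⟩⟩ := by
  obtain ⟨h1, h2⟩ := hγ
  rw [div_le_iff₀ (by positivity)] at h1
  rw [le_div_iff₀ (by positivity)] at h2
  have hre : ((1 : ℂ) + ((2 * γ : ℝ) : ℂ) * I).re = (1 : ℤ) := by simp
  have him : ((1 : ℂ) + ((2 * γ : ℝ) : ℂ) * I).im = 2 * γ := by simp
  constructor
  · rw [hre]; exact MI.mem_ofInt SZ 1
  · rw [him]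
    have hp : (0 : ℝ) ≤ 2 ^ 91 := by positivity
    have e : (2 : ℝ) ^ 91 = 2 * 2 ^ 90 := by norm_num
    constructor
    · simp only [Int.cast_mul, Int.cast_pow, Int.cast_ofNat]
      rw [SZ_eq]
      nlinarith [h1]
    · simp only [Int.cast_mul, Int.cast_pow, Int.cast_ofNat, Int.cast_add, Int.cast_one]
      rw [SZ_eq]
      nlinarith [h2]

/-- **Soundness of the per-zero computation.** With `t₁ = a 2^{-240}`, `t₂ = (a+1) 2^{-240}`,
`2 ≤ t₁`, `t₂ ≤ T₁`: for every `γ ∈ [t₁, t₂]` with `ζ(½+iγ) = 0`, the summands `termP y_L γ`,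
`termT y_T γ` are bounded by `lo / SZ` from below, `hi / SZ` from above. [folklore] -/
theorem zeroTerm_sound {T : Tables} (hT : T.Valid) (hTS : T.S = SZ) {a : ℤ}
    (ha2 : 2 * 2 ^ 240 ≤ a) (haT : a + 1 ≤ (heightT1 : ℤ) * 2 ^ 240) {vlo vhi : ℤ}
    (h : zeroTerm T a = some (vlo, vhi)) :
    ∀ γ : ℝ, γ ∈ Set.Icc ((a : ℝ) / 2 ^ 240) (((a : ℝ) + 1) / 2 ^ 240) →
      (vlo : ℝ) ≤ termP yL γ * SZ ∧ termT yT γ * SZ ≤ vhi := by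
  -- the real numbers
  set t₁' : ℝ := (a : ℝ) / 2 ^ 240 with ht₁
  set t₂' : ℝ := ((a : ℝ) + 1) / 2 ^ 240 with ht₂
  have h2p : (0 : ℝ) < 2 ^ 240 := by positivity
  have ha2r : (2 : ℝ) * 2 ^ 240 ≤ a := by exact_mod_cast ha2
  have haTr : (a : ℝ) + 1 ≤ heightT1 * 2 ^ 240 := by exact_mod_cast haT
  have ht1 : 2 ≤ t₁' := by rw [ht₁, le_div_iff₀ h2p]; linarith
  have ht12 : t₁' < t₂' := by rw [ht₁, ht₂]; gcongr; linarith
  have ht2T : t₂' ≤ heightT1 := by rw [ht₂, div_le_iff₀ h2p]; linarith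
  have hgap : t₂' - t₁' = 1 / 2 ^ 240 := by rw [ht₁, ht₂]; field_simp; ring
  intro γ hγ
  -- unfold the computation
  unfold zeroTerm at h
  simp only at h
  split at h
  · rename_i Z1 Z2 ZZ hZ1 hZ2 hZZ
    split at h
    · simp at h
    · rename_i g hg
      split at h
      · rename_i FL FT hFL hFT
        simp only [Option.some.injEq, Prod.mk.injEq] at h
        obtain ⟨hlo, hhi⟩ := h
        -- the two values of `ζ` on the line
        have hs1 : (1 / 2 : ℂ) + t₁' * I ≠ 1 := fun h ↦ by
          have := congrArg Complex.im h; simp at this; linarith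
        have hs2 : (1 / 2 : ℂ) + t₂' * I ≠ 1 := fun h ↦ by
          have := congrArg Complex.im h; simp at this; linarith
        have hin1 : MC.mem T.S (1 / 2 + t₁' * I) ⟨halfZ, MI.ofScaled (a * 2 ^ 90)⟩ := by
          rw [hTS]; exact mem_inputBox (a := a) rfl
        have hin2 : MC.mem T.S (1 / 2 + t₂' * I) ⟨halfZ, MI.ofScaled ((a + 1) * 2 ^ 90)⟩ := by
          rw [hTS]; exact mem_inputBox (a := a + 1) (by rw [ht₂]; push_cast; ring)
        have hm1 := mem_zetaBox hT hin1 hs1 hZ1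
        have hm2 := mem_zetaBox hT hin2 hs2 hZ2
        rw [hTS] at hm1 hm2
        -- the value `ζ(1 + 2iγ)`
        have hγ0 : 0 ≤ γ := by linarith [hγ.1]
        have hs3 : (1 : ℂ) + ((2 * γ : ℝ) : ℂ) * I ≠ 1 := fun h ↦ by
          have := congrArg Complex.im h; simp at this; linarith [hγ.1]
        have hin3 : MC.mem T.S (1 + ((2 * γ : ℝ) : ℂ) * I) ⟨MI.ofInt SZ 1, ⟨a * 2 ^ 91, (a + 1) * 2 ^ 91⟩⟩ := by
          rw [hTS]; exact mem_inputBox2 hγ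
        have hm3 := mem_zetaBox hT hin3 hs3 hZZ
        rw [hTS] at hm3
        have hm3' : MC.mem SZ (riemannZeta (1 + (2 * γ) * I)) ZZ := by
          have e : (1 : ℂ) + ((2 * γ : ℝ) : ℂ) * I = 1 + (2 * γ) * I := by push_cast; ring
          rwa [e] at hm3
        -- the kernel
        have hG := mem_bracket hγ
        have hγT : γ ≤ heightT1 := by linarith [hγ.2]
        have hgm := mem_kernelBoxL hT hTS hg hG hγ0 hγT
        -- `ζ'(ρ)` from the slope
        have hslope := norm_deriv_riemannZeta_sub_slope_le ht1 ht12 hγ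
        have hD0 : MC.mem SZ ((riemannZeta (1 / 2 + t₂' * I) - riemannZeta (1 / 2 + t₁' * I)) /
            ((t₂' - t₁' : ℝ) * I)) (MC.mulNegI ((Z2.sub Z1).mulInt (2 ^ 240))) := by
          have := MC.mem_mulNegI (MC.mem_mulInt (MC.mem_sub hm2 hm1) (2 ^ 240))
          convert this using 1
          rw [hgap, div_eq_mul_inv, mul_inv, Complex.inv_I]
          push_cast
          ring
        have hD : MC.mem SZ (deriv riemannZeta (1 / 2 + γ * I))
            ((MC.mulNegI ((Z2.sub Z1).mulInt (2 ^ 240))).widen rSlope) := by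
          apply MC.mem_widen hD0
          refine (mul_le_mul_of_nonneg_right hslope (by positivity)).trans ?_
          rw [hgap, SZ_eq]
          unfold rSlope
          push_cast
          have h4 : 0 ≤ t₂' + 4 := by linarith
          have hT01 : (heightT1 : ℝ) ≤ heightT0 := by rw [heightT1_real, heightT0_real]; norm_num
          have hc : (t₂' + 4) ^ 3 ≤ ((heightT0 : ℝ) + 4) ^ 3 :=
            pow_le_pow_left₀ h4 (by linarith) 3
          have : (1 : ℝ) / 2 ^ 240 * (4 * (t₂' + 4) ^ 3) * (2 ^ 240 * 2 ^ 90) =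
              2 ^ 90 * 4 * (t₂' + 4) ^ 3 := by field_simp
          rw [this]
          nlinarith [hc]
        have hhalf : MI.mem SZ ((1 : ℤ) / (2 : ℕ) : ℝ) halfZ := by
          simp only [halfZ]; exact MI.mem_ofFrac SZ 1 (q := 2) (by norm_num)
        have hρ : MC.mem SZ ((1 / 2 : ℂ) + γ * I) ⟨halfZ, ⟨a * 2 ^ 90, (a + 1) * 2 ^ 90⟩⟩ := by
          constructor
          · convert hhalf using 1; simp
          · simpa using hG
        have hρ1 : MC.mem SZ ((1 / 2 : ℂ) - 1 + γ * I) ⟨halfZ.sub (MI.ofInt SZ 1), ⟨a * 2 ^ 90, (a + 1) * 2 ^ 90⟩⟩ := by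
          constructor
          · have := MI.mem_sub hhalf (MI.mem_ofInt SZ 1)
            convert this using 1; simp
          · simpa using hG
        have hDenL := MC.mem_mul SZ_pos hρ hD
        have hDenT := MC.mem_mul SZ_pos hρ1 hD
        have hPL := mem_termBoxZ hT hTS hFL hG hgm hm3' hDenL
        have hPT := mem_termBoxZ hT hTS hFT hG hgm hm3' hDenT
        rw [← hlo, ← hhi]
        constructor
        · have := hPL.1
          rw [termP_eq]
          unfold yL
          exact this
        · have := hPT.2
          rw [termT_eq]
          unfold yT
          exact this
      · simp at h
  · simp at h

/-! ### One block -/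

/-- Soundness of `chunkSums`: if every zero `j` of block `k` below `i` has a bracket with
`2 ≤ t₁ j` and `t₂ j ≤ T₁`, the accumulated sums bound the sums of the summands over the block
for every choice of `γ_j` in the brackets. [folklore] -/
theorem chunkSums_sound {T : Tables} (hT : T.Valid) (hTS : T.S = SZ) (k : ℕ) :
    ∀ (i : ℕ) {sl sh : ℤ}, chunkSums T k i = some (sl, sh) →
      (∀ i' < i, 2 * 2 ^ 240 ≤ ordinate (k * CHUNK + i') ∧
        ordinate (k * CHUNK + i') + 1 ≤ (heightT1 : ℤ) * 2 ^ 240) →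
      ∀ γ : ℕ → ℝ, (∀ i' < i, γ (k * CHUNK + i') ∈
          Set.Icc (t₁ (k * CHUNK + i')) (t₂ (k * CHUNK + i'))) →
        (sl : ℝ) ≤ (∑ i' ∈ Finset.range i, termP yL (γ (k * CHUNK + i'))) * SZ ∧
          (∑ i' ∈ Finset.range i, termT yT (γ (k * CHUNK + i'))) * SZ ≤ sh
  | 0, sl, sh, h, _ => by
    simp only [chunkSums, Option.some.injEq, Prod.mk.injEq] at h
    obtain ⟨rfl, rfl⟩ := h
    exact fun γ _ ↦ by simp
  | i + 1, sl, sh, h, hord => by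
    simp only [chunkSums] at h
    split at h
    · simp at h
    · rename_i sl0 sh0 hprev
      split at h
      · rename_i vlo vhi hz
        simp only [Option.some.injEq, Prod.mk.injEq] at h
        obtain ⟨rfl, rfl⟩ := h
        have ih := chunkSums_sound hT hTS k i hprev (fun i' hi' ↦ hord i' (Nat.lt_succ_of_lt hi'))
        obtain ⟨ha2, haT⟩ := hord i (Nat.lt_succ_self i)
        have hbd := zeroTerm_sound hT hTS ha2 haT hz
        have ht1 : t₁ (k * CHUNK + i) = (ordinate (k * CHUNK + i) : ℝ) / 2 ^ 240 := rfl
        have ht2 : t₂ (k * CHUNK + i) = ((ordinate (k * CHUNK + i) : ℝ) + 1) / 2 ^ 240 := rfl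
        intro γ hγ
        obtain ⟨hs1, hs2⟩ := ih γ fun i' hi' ↦ hγ i' (Nat.lt_succ_of_lt hi')
        have hγi := hγ i (Nat.lt_succ_self i)
        rw [ht1, ht2] at hγi
        obtain ⟨hb1, hb2⟩ := hbd (γ (k * CHUNK + i)) hγi
        rw [Finset.sum_range_succ, Finset.sum_range_succ, add_mul, add_mul]
        push_cast
        constructor <;> linarith
      · simp at h

set_option exponentiation.threshold 512 in
/-- What a passed block check (with valid tables at scale `SZ`) gives. [folklore] -/
theorem checkChunkWith_sound {T : Tables} (hT : T.Valid) (hTS : T.S = SZ) {k : ℕ}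
    (h : checkChunkWith T k = true)
    (hord : ∀ i < chunkLen k, 2 * 2 ^ 240 ≤ ordinate (k * CHUNK + i) ∧
      ordinate (k * CHUNK + i) + 1 ≤ (heightT1 : ℤ) * 2 ^ 240) :
    ∀ γ : ℕ → ℝ, (∀ i < chunkLen k, γ (k * CHUNK + i) ∈ Set.Icc (t₁ (k * CHUNK + i)) (t₂ (k * CHUNK + i))) →
      ((chunkBounds.getD k (0, 0)).1 : ℝ) / 2 ^ 60 ≤ ∑ i ∈ Finset.range (chunkLen k), termP yL (γ (k * CHUNK + i)) ∧
        ∑ i ∈ Finset.range (chunkLen k), termT yT (γ (k * CHUNK + i)) ≤ ((chunkBounds.getD k (0, 0)).2 : ℝ) / 2 ^ 60 := by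
  unfold checkChunkWith at h
  generalize hcs : chunkSums T k (chunkLen k) = r at h
  rcases r with _ | ⟨sl, sh⟩
  · simp [boundsOk] at h
  · simp only [boundsOk, decide_eq_true_eq] at h
    have hdec := h
    intro γ hγ
    obtain ⟨hs1, hs2⟩ := chunkSums_sound hT hTS k (chunkLen k) hcs hord γ hγ
    have hSZ : (SZ : ℝ) = 2 ^ 60 * 2 ^ 270 := by
      unfold SZ; rw [Nat.cast_pow, Nat.cast_ofNat, ← pow_add]
    have e1 : (((chunkBounds.getD k (0, 0)).1 : ℤ) : ℝ) * 2 ^ 270 ≤ sl := by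
      have := Int.cast_le (R := ℝ) |>.2 hdec.1
      simp only [Int.cast_mul, Int.cast_pow, Int.cast_ofNat] at this
      linarith
    have e2 : (sh : ℝ) ≤ (((chunkBounds.getD k (0, 0)).2 : ℤ) : ℝ) * 2 ^ 270 := by
      have := Int.cast_le (R := ℝ) |>.2 hdec.2
      simp only [Int.cast_mul, Int.cast_pow, Int.cast_ofNat] at this
      linarith
    rw [hSZ] at hs1 hs2
    have hp : (0 : ℝ) < 2 ^ 270 := by positivity
    constructor
    · rw [div_le_iff₀ (by positivity)]
      have key : (((chunkBounds.getD k (0, 0)).1 : ℤ) : ℝ) * 2 ^ 270 ≤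
          (∑ i ∈ Finset.range (chunkLen k), termP yL (γ (k * CHUNK + i))) * 2 ^ 60 * 2 ^ 270 := by
        linarith
      exact le_of_mul_le_mul_right key hp
    · rw [le_div_iff₀ (by positivity)]
      have key : (∑ i ∈ Finset.range (chunkLen k), termT yT (γ (k * CHUNK + i))) * 2 ^ 60 * 2 ^ 270 ≤
          (((chunkBounds.getD k (0, 0)).2 : ℤ) : ℝ) * 2 ^ 270 := by
        linarith
      exact le_of_mul_le_mul_right key hp

/-- What a passed block check gives. [folklore] -/
theorem checkChunk_sound' {k : ℕ} (h : checkChunk k = true)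
    (hord : ∀ i < chunkLen k, 2 * 2 ^ 240 ≤ ordinate (k * CHUNK + i) ∧
      ordinate (k * CHUNK + i) + 1 ≤ (heightT1 : ℤ) * 2 ^ 240) :
    ∀ γ : ℕ → ℝ, (∀ i < chunkLen k, γ (k * CHUNK + i) ∈ Set.Icc (t₁ (k * CHUNK + i)) (t₂ (k * CHUNK + i))) →
      ((chunkBounds.getD k (0, 0)).1 : ℝ) / 2 ^ 60 ≤ ∑ i ∈ Finset.range (chunkLen k), termP yL (γ (k * CHUNK + i)) ∧
        ∑ i ∈ Finset.range (chunkLen k), termT yT (γ (k * CHUNK + i)) ≤ ((chunkBounds.getD k (0, 0)).2 : ℝ) / 2 ^ 60 := by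
  unfold checkChunk at h
  generalize hTab : tablesZ = o at h
  rcases o with _ | T
  · simp at h
  · simp only [Option.map_some, Option.getD_some] at h
    exact checkChunkWith_sound (tablesZ_valid hTab) (tablesZ_S hTab) h hord

/-! ### The final check -/

set_option exponentiation.threshold 512 in
/-- What a passed final check gives: the bracket range and the two inequalities against a lower
bound of `Re (1/ζ(½))`. [folklore] -/
theorem final_of_checkFinal (h : checkFinal = true) :
    (ordinate (NZL - 1) + 1 ≤ (heightT1 : ℤ) * 2 ^ 240 ∧ (heightT1 : ℤ) * 2 ^ 240 ≤ ordinate NZL) ∧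
    0 < (1 / riemannZeta (1 / 2)).re + (sumL : ℝ) / 2 ^ 60 ∧
    -(1 / riemannZeta (1 / 2)).re + (sumU : ℝ) / 2 ^ 60 < 0 := by
  unfold checkFinal at h
  generalize hTab : tablesZ = o at h
  rcases o with _ | T
  · simp at h
  · simp only [Option.map_some, Option.getD_some] at h
    have hT : T.Valid := tablesZ_valid hTab
    have hTS : T.S = SZ := tablesZ_S hTab
    unfold checkFinalWith at h
    split at h
    · simp at h
    · rename_i ZH hZH
      split at h
      · simp at h
      · rename_i IZ hIZ
        simp only [Bool.and_eq_true, decide_eq_true_eq] at h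
        obtain ⟨hr, h1, h2⟩ := h
        refine ⟨of_decide_eq_true hr, ?_⟩
        -- the enclosure of `1/ζ(½)`
        have hhalf : MI.mem SZ ((1 : ℤ) / (2 : ℕ) : ℝ) halfZ := by
          simp only [halfZ]; exact MI.mem_ofFrac SZ 1 (q := 2) (by norm_num)
        have hin : MC.mem T.S ((1 / 2 : ℂ)) ⟨halfZ, MI.ofInt SZ 0⟩ := by
          rw [hTS]
          constructor
          · convert hhalf using 1; simp
          · have := MI.mem_ofInt SZ 0; simpa using this
        have hs1 : (1 / 2 : ℂ) ≠ 1 := by norm_num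
        have hm := mem_zetaBox hT hin hs1 hZH
        rw [hTS] at hm
        have hinv := MC.mem_divBox SZ_pos hIZ (MC.mem_ofInt SZ 1) hm
        have hre := hinv.1
        simp only [Int.cast_one] at hre
        have hlo := MI.lo_div_le SZ_pos hre
        -- read in `ℝ`
        have hSZ : (SZ : ℝ) = 2 ^ 60 * 2 ^ 270 := by
          unfold SZ; rw [Nat.cast_pow, Nat.cast_ofNat, ← pow_add]
        have hSpos : (0 : ℝ) < SZ := by exact_mod_cast SZ_pos
        have h1' : (0 : ℝ) < IZ.re.lo + sumL * 2 ^ 270 := by exact_mod_cast h1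
        have h2' : (sumU : ℝ) * 2 ^ 270 < IZ.re.lo := by exact_mod_cast h2
        have e1 : (sumL : ℝ) / 2 ^ 60 = (sumL : ℝ) * 2 ^ 270 / SZ := by
          rw [hSZ]; field_simp
        have e2 : (sumU : ℝ) / 2 ^ 60 = (sumU : ℝ) * 2 ^ 270 / SZ := by
          rw [hSZ]; field_simp
        rw [e1, e2]
        constructor
        · have : (0 : ℝ) < (IZ.re.lo : ℝ) / SZ + sumL * 2 ^ 270 / SZ := by
            rw [← add_div]; exact div_pos h1' hSpos
          linarith
        · have : (sumU : ℝ) * 2 ^ 270 / SZ < (IZ.re.lo : ℝ) / SZ := div_lt_div_of_pos_right h2' hSpos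
          linarith

/-! ### The sums over the certified zeros -/

/-- **A kernel sum over the certified zeros.** For `F` with `F(ρ̄) = conj F(ρ)`,
`Re Σ_{ρ : 0<β<1, |γ|<T} F(ρ) = Σ_{γ ∈ Z} 2 Re F(½+iγ)` once the zeros below `T` are `½ ± iγ`,
`γ ∈ Z` (as `re_inghamSum_eq_sum_of_zeros`, which is the case `F = k(γ)e^{iγy}/(ρζ'(ρ))`).
[cite: OdlyzkoTeRiele1985, Theorem p. 144 (display after (2.18))] -/
theorem re_sum_zetaZerosBelow_eq {T : ℝ} (Z : Finset ℝ)
    (hZ : ∀ γ ∈ Z, riemannZeta (1 / 2 + γ * I) = 0 ∧ 0 < γ ∧ γ < T)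
    (hline : ∀ ρ : ℂ, riemannZeta ρ = 0 → 0 < ρ.re → ρ.re < 1 → |ρ.im| < T → ρ.re = 1 / 2)
    (hall : ∀ ρ : ℂ, riemannZeta ρ = 0 → 0 < ρ.re → ρ.re < 1 → 0 < ρ.im → ρ.im < T → ρ.im ∈ Z)
    (F : ℂ → ℂ) (hF : ∀ ρ : ℂ, F (starRingEnd ℂ ρ) = starRingEnd ℂ (F ρ)) :
    (∑ ρ ∈ (zetaZerosBelow_finite T).toFinset, F ρ).re = ∑ γ ∈ Z, 2 * (F (1 / 2 + γ * I)).re := by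
  classical
  rw [zetaZerosBelow_toFinset_eq Z hZ hline hall]
  have hinj1 : Function.Injective (fun γ : ℝ ↦ (1 / 2 : ℂ) + γ * I) := by
    intro a b h; have := congrArg Complex.im h; simpa using this
  have hinj2 : Function.Injective (fun γ : ℝ ↦ (1 / 2 : ℂ) - γ * I) := by
    intro a b h; have := congrArg Complex.im h; simpa using this
  have hdisj : Disjoint (Z.image (fun γ : ℝ ↦ (1 / 2 : ℂ) + γ * I))
      (Z.image (fun γ : ℝ ↦ (1 / 2 : ℂ) - γ * I)) := by
    rw [Finset.disjoint_left]
    intro ρ h1 h2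
    rw [Finset.mem_image] at h1 h2
    obtain ⟨a, ha, rfl⟩ := h1
    obtain ⟨b, hb, hab⟩ := h2
    have := congrArg Complex.im hab
    simp at this
    have ha0 := (hZ a ha).2.1
    have hb0 := (hZ b hb).2.1
    linarith
  rw [Finset.sum_union hdisj, Finset.sum_image (fun a _ b _ h ↦ hinj1 h),
    Finset.sum_image (fun a _ b _ h ↦ hinj2 h), Complex.add_re, Complex.re_sum, Complex.re_sum,
    ← Finset.sum_add_distrib]
  refine Finset.sum_congr rfl fun γ _ ↦ ?_
  have hconj : (1 / 2 : ℂ) - γ * I = starRingEnd ℂ (1 / 2 + γ * I) := by apply Complex.ext <;> simp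
  rw [hconj, hF, Complex.conj_re]
  ring

/-- `e^{i(-γ)y} = conj e^{iγy}` for real `γ`, `y`. [folklore] -/
lemma cexp_neg_im_mul (γ y : ℝ) :
    cexp (I * (((-γ : ℝ) : ℂ) * y)) = starRingEnd ℂ (cexp (I * ((γ : ℂ) * y))) := by
  rw [← Complex.exp_conj]
  congr 1
  simp only [map_mul, Complex.conj_I, Complex.conj_ofReal, Complex.ofReal_neg]
  ring

/-- The summand of `A*` is conjugation-equivariant (`k` real and even, `ζ(2ρ̄) = conj ζ(2ρ)`,
`ζ'(ρ̄) = conj ζ'(ρ)`). [folklore] -/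
theorem polyaSummand_conj (y : ℝ) (ρ : ℂ) :
    kL (starRingEnd ℂ ρ).im * cexp (I * ((starRingEnd ℂ ρ).im * y)) *
        (riemannZeta (2 * starRingEnd ℂ ρ) / (starRingEnd ℂ ρ * deriv riemannZeta (starRingEnd ℂ ρ))) =
      starRingEnd ℂ (kL ρ.im * cexp (I * (ρ.im * y)) * (riemannZeta (2 * ρ) / (ρ * deriv riemannZeta ρ))) := by
  have him : (starRingEnd ℂ ρ).im = -ρ.im := Complex.conj_im ρ
  have hk : kL (starRingEnd ℂ ρ).im = starRingEnd ℂ (kL ρ.im) := by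
    rw [him]; unfold kL; rw [neg_div, jurkatPeyerimhoffKernel_neg, Complex.conj_ofReal]
  have he : cexp (I * (((starRingEnd ℂ ρ).im : ℂ) * y)) = starRingEnd ℂ (cexp (I * ((ρ.im : ℂ) * y))) := by
    rw [him]; exact cexp_neg_im_mul ρ.im y
  have hz : riemannZeta (2 * starRingEnd ℂ ρ) = starRingEnd ℂ (riemannZeta (2 * ρ)) := by
    rw [← riemannZeta_conj, map_mul, map_ofNat]
  rw [hk, he, hz, deriv_riemannZeta_conj, ← map_mul, ← map_mul, ← map_div₀, ← map_mul]

/-- Likewise for the summand of `B*` (`ρ̄ - 1 = conj (ρ - 1)`). [folklore] -/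
theorem turanSummand_conj (y : ℝ) (ρ : ℂ) :
    kL (starRingEnd ℂ ρ).im * cexp (I * ((starRingEnd ℂ ρ).im * y)) *
        (riemannZeta (2 * starRingEnd ℂ ρ) / ((starRingEnd ℂ ρ - 1) * deriv riemannZeta (starRingEnd ℂ ρ))) =
      starRingEnd ℂ (kL ρ.im * cexp (I * (ρ.im * y)) * (riemannZeta (2 * ρ) / ((ρ - 1) * deriv riemannZeta ρ))) := by
  have him : (starRingEnd ℂ ρ).im = -ρ.im := Complex.conj_im ρ
  have hk : kL (starRingEnd ℂ ρ).im = starRingEnd ℂ (kL ρ.im) := by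
    rw [him]; unfold kL; rw [neg_div, jurkatPeyerimhoffKernel_neg, Complex.conj_ofReal]
  have he : cexp (I * (((starRingEnd ℂ ρ).im : ℂ) * y)) = starRingEnd ℂ (cexp (I * ((ρ.im : ℂ) * y))) := by
    rw [him]; exact cexp_neg_im_mul ρ.im y
  have hz : riemannZeta (2 * starRingEnd ℂ ρ) = starRingEnd ℂ (riemannZeta (2 * ρ)) := by
    rw [← riemannZeta_conj, map_mul, map_ofNat]
  have h1 : starRingEnd ℂ ρ - 1 = starRingEnd ℂ (ρ - 1) := by rw [map_sub, map_one]
  rw [hk, he, hz, h1, deriv_riemannZeta_conj, ← map_mul, ← map_mul, ← map_div₀, ← map_mul]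

/-! ### Assembly -/

/-- **Soundness of the whole certificate**: the Mertens zero checks (brackets and count at
`T = 2516`), the seven block checks and the final check imply the numerical content of Haselgrove's
disproof in the tree's objects: every zero of `ζ` with `0 < Re ρ < 1`, `|Im ρ| < 2516` is simple and
on the line, `Re A*(y_L) > 0` and `Re B*(y_T) < 0` for the Jurkat–Peyerimhoff weight `kL = g(·/1000)`
(Haselgrove: `m = 1000`, `A*(831.847) ≈ .00495 > 0`, `B*(996.980) < 0`).
[cite: BorweinFergusonMossinghoff2008, §1 pp. 1683–1684; HaselgroveMathematika1958] -/
theorem numerics_of_checks (hM : ∀ k < NCHUNK, Mertens.checkChunk k = true) (hTop : Mertens.checkTop = true)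
    (hCh : ∀ k < NCHUNKL, checkChunk k = true) (hFin : checkFinal = true) :
    (∀ ρ : ℂ, riemannZeta ρ = 0 → 0 < ρ.re → ρ.re < 1 → |ρ.im| < heightT0 →
        ρ.re = 1 / 2 ∧ deriv riemannZeta ρ ≠ 0) ∧
      0 < (polyaKernelSum kL heightT0 yL).re ∧ (turanKernelSum kL heightT0 yT).re < 0 := by
  classical
  have hNZ : NZ = NCHUNK * CHUNK := by unfold NZ NCHUNK CHUNK; norm_num
  -- per-zero facts from the Mertens certificate
  have hfact : ∀ j < NZ, orderOk j = true ∧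
      ∃ γ ∈ Set.Icc (t₁ j) (t₂ j), riemannZeta (1 / 2 + γ * I) = 0 := by
    intro j hj
    have hk : j / CHUNK < NCHUNK := by
      rw [hNZ] at hj; exact Nat.div_lt_of_lt_mul (by rwa [mul_comm] at hj)
    have hi : j % CHUNK < CHUNK := Nat.mod_lt _ (by unfold CHUNK; norm_num)
    have := (checkChunk_sound (hM _ hk)).1 (j % CHUNK) hi
    rwa [Nat.div_add_mod'] at this
  -- the ordinates
  set γ : ℕ → ℝ := fun j ↦ if h : j < NZ then (hfact j h).2.choose else 0 with hγdef
  have hγ : ∀ j < NZ, γ j ∈ Set.Icc (t₁ j) (t₂ j) ∧ riemannZeta (1 / 2 + γ j * I) = 0 := by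
    intro j hj
    have := (hfact j hj).2.choose_spec
    simp only [hγdef, dif_pos hj]
    exact this
  have hordZ : ∀ j < NZ, 2 * 2 ^ 240 ≤ ordinate j ∧ ordinate j + 1 < (heightT0 : ℤ) * 2 ^ 240 ∧
      (j + 1 < NZ → ordinate j + 1 < ordinate (j + 1)) := fun j hj ↦ orderOk_sound (hfact j hj).1
  have h2p : (0 : ℝ) < 2 ^ 240 := by positivity
  have hord : ∀ j < NZ, 2 ≤ t₁ j ∧ t₂ j < heightT0 ∧ (j + 1 < NZ → t₂ j < t₁ (j + 1)) := by
    intro j hj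
    obtain ⟨h1, h2, h3⟩ := hordZ j hj
    refine ⟨?_, ?_, fun hj1 ↦ ?_⟩
    · unfold t₁; rw [le_div_iff₀ h2p]; exact_mod_cast h1
    · unfold t₂; rw [div_lt_iff₀ h2p]; exact_mod_cast h2
    · unfold t₁ t₂; rw [div_lt_div_iff_of_pos_right h2p]; exact_mod_cast h3 hj1
  have ht12 : ∀ j, t₁ j < t₂ j := fun j ↦ by
    unfold t₁ t₂; gcongr; linarith
  have hsep : ∀ j j', j < j' → j' < NZ → t₂ j < t₁ j' := by
    intro j j' hjj' hj'
    induction j' with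
    | zero => exact absurd hjj' (Nat.not_lt_zero _)
    | succ j' ih =>
      rcases Nat.lt_succ_iff_lt_or_eq.1 hjj' with hlt | heq
      · have := ih hlt (by omega)
        have h2 := (hord j' (by omega)).2.2 hj'
        linarith [ht12 j']
      · subst heq; exact (hord j (by omega)).2.2 hj'
  have hinj : Set.InjOn γ (Finset.range NZ : Set ℕ) := by
    intro j hj j' hj' h
    simp only [Finset.coe_range, Set.mem_Iio] at hj hj'
    by_contra hne
    rcases lt_or_gt_of_ne hne with hlt | hlt
    · have := hsep j j' hlt hj'
      linarith [(hγ j hj).1.2, (hγ j' hj').1.1]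
    · have := hsep j' j hlt hj
      linarith [(hγ j' hj').1.2, (hγ j hj).1.1]
  set Z : Finset ℝ := (Finset.range NZ).image γ with hZdef
  have hZcard : Z.card = NZ := by
    rw [hZdef, Finset.card_image_of_injOn hinj, Finset.card_range]
  have hZ : ∀ γ' ∈ Z, riemannZeta (1 / 2 + γ' * I) = 0 ∧ 0 < γ' ∧ γ' < heightT0 := by
    intro γ' hγ'
    rw [hZdef, Finset.mem_image] at hγ'
    obtain ⟨j, hj, rfl⟩ := hγ'
    rw [Finset.mem_range] at hj
    obtain ⟨hI, h0⟩ := hγ j hj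
    obtain ⟨h1, h2, -⟩ := hord j hj
    exact ⟨h0, by linarith [hI.1], by linarith [hI.2]⟩
  -- the count and the zero clause
  have hN : zetaZeroCount heightT0 = Z.card := by
    rw [zetaZeroCount_of_checkTop hTop, hZcard]; rfl
  obtain ⟨hclause, hall⟩ := zeros_below_of_count_eq_card Z hZ hN
  have hline : ∀ ρ : ℂ, riemannZeta ρ = 0 → 0 < ρ.re → ρ.re < 1 → |ρ.im| < heightT0 → ρ.re = 1 / 2 :=
    fun ρ h0 h1 h2 h3 ↦ (hclause ρ h0 h1 h2 h3).1
  -- the final check: range and the constant term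
  obtain ⟨⟨hr1, hr2⟩, hFL, hFU⟩ := final_of_checkFinal hFin
  have hNZL : NZL < NZ := by unfold NZL NZ; norm_num
  have hNZL1 : NZL - 1 < NZ := by unfold NZL NZ; norm_num
  have ht2L : t₂ (NZL - 1) ≤ heightT1 := by
    unfold t₂; rw [div_le_iff₀ h2p]; exact_mod_cast hr1
  have ht1L : (heightT1 : ℝ) ≤ t₁ NZL := by
    unfold t₁; rw [le_div_iff₀ h2p]; exact_mod_cast hr2
  -- zeros `j ≥ NZL` have `γ j ≥ T₁` (their summands vanish), zeros `j < NZL` have `γ j ≤ T₁`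
  have hbig : ∀ j, NZL ≤ j → j < NZ → (heightT1 : ℝ) ≤ γ j := by
    intro j hj1 hj2
    rcases eq_or_lt_of_le hj1 with heq | hlt
    · subst heq; exact ht1L.trans (hγ _ hj2).1.1
    · have := hsep NZL j hlt hj2
      linarith [(hγ j hj2).1.1, ht12 NZL]
  have hsmall : ∀ j, j < NZL → 2 * 2 ^ 240 ≤ ordinate j ∧ ordinate j + 1 ≤ (heightT1 : ℤ) * 2 ^ 240 := by
    intro j hj
    refine ⟨(hordZ j (hj.trans hNZL)).1, ?_⟩
    rcases eq_or_lt_of_le (Nat.le_sub_one_of_lt hj) with heq | hlt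
    · rw [heq]; exact hr1
    · have h1 : t₂ j < t₁ (NZL - 1) := hsep j (NZL - 1) hlt hNZL1
      have h2 : t₂ j ≤ heightT1 := by linarith [ht12 (NZL - 1)]
      unfold t₂ at h2; rw [div_le_iff₀ h2p] at h2; exact_mod_cast h2
  have hkL_zero : ∀ j, NZL ≤ j → j < NZ → kL (γ j) = 0 := by
    intro j hj1 hj2
    unfold kL
    rw [jurkatPeyerimhoffKernel_of_one_le_abs, Complex.ofReal_zero]
    rw [abs_div, abs_of_nonneg (by linarith [hbig j hj1 hj2, heightT1_real] : (0 : ℝ) ≤ γ j),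
      abs_of_pos (by rw [heightT1_real]; norm_num), le_div_iff₀ (by rw [heightT1_real]; norm_num), one_mul]
    exact hbig j hj1 hj2
  -- the sums over all zeros below `T₀` reduce to the first `NZL` zeros
  have hsplit : ∀ f : ℝ → ℝ, (∀ j, NZL ≤ j → j < NZ → f (γ j) = 0) →
      ∑ γ' ∈ Z, f γ' = ∑ k ∈ Finset.range NCHUNKL, ∑ i ∈ Finset.range (chunkLen k), f (γ (k * CHUNK + i)) := by
    intro f hf
    rw [hZdef, Finset.sum_image hinj]
    have hNZ' : NZ = NZL + (NZ - NZL) := by omega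
    rw [hNZ', Finset.sum_range_add]
    have hzero : ∑ x ∈ Finset.range (NZ - NZL), f (γ (NZL + x)) = 0 :=
      Finset.sum_eq_zero fun x hx ↦ hf _ (by omega) (by rw [Finset.mem_range] at hx; omega)
    rw [hzero, add_zero]
    have hL : NZL = 6 * CHUNK + 49 := by unfold NZL CHUNK; norm_num
    have h7 : NCHUNKL = 6 + 1 := by unfold NCHUNKL; norm_num
    have hcl : ∀ k ∈ Finset.range 6, ∑ i ∈ Finset.range (chunkLen k), f (γ (k * CHUNK + i)) =
        ∑ i ∈ Finset.range CHUNK, f (γ (k * CHUNK + i)) := by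
      intro k hk
      rw [Finset.mem_range] at hk
      have : chunkLen k = CHUNK := by unfold chunkLen NZL CHUNK; omega
      rw [this]
    have h49 : chunkLen 6 = 49 := by unfold chunkLen NZL CHUNK; norm_num
    rw [hL, Finset.sum_range_add, sum_range_mul, h7]
    conv_rhs => rw [Finset.sum_range_succ, Finset.sum_congr rfl hcl, h49]
  have hsumP : ∀ y : ℝ, (polyaKernelSum kL heightT0 y).re =
      (1 / riemannZeta (1 / 2)).re + ∑ k ∈ Finset.range NCHUNKL, ∑ i ∈ Finset.range (chunkLen k),
        termP y (γ (k * CHUNK + i)) := by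
    intro y
    unfold polyaKernelSum
    rw [Complex.add_re, re_sum_zetaZerosBelow_eq Z hZ hline hall _ (polyaSummand_conj y)]
    refine congrArg ((1 / riemannZeta (1 / 2)).re + ·) ?_
    refine hsplit (fun γ' ↦ 2 * (kL ((1 / 2 : ℂ) + γ' * I).im * cexp (I * (((1 / 2 : ℂ) + γ' * I).im * y)) *
      (riemannZeta (2 * (1 / 2 + γ' * I)) / ((1 / 2 + γ' * I) * deriv riemannZeta (1 / 2 + γ' * I)))).re) ?_ |>.trans ?_
    · intro j hj1 hj2
      have him : ((1 / 2 : ℂ) + (γ j : ℂ) * I).im = γ j := by simp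
      rw [him, hkL_zero j hj1 hj2]; simp
    · refine Finset.sum_congr rfl fun k _ ↦ Finset.sum_congr rfl fun i _ ↦ ?_
      have him : ((1 / 2 : ℂ) + (γ (k * CHUNK + i) : ℂ) * I).im = γ (k * CHUNK + i) := by simp
      rw [him]; rfl
  have hsumT : ∀ y : ℝ, (turanKernelSum kL heightT0 y).re =
      -(1 / riemannZeta (1 / 2)).re + ∑ k ∈ Finset.range NCHUNKL, ∑ i ∈ Finset.range (chunkLen k),
        termT y (γ (k * CHUNK + i)) := by
    intro y
    unfold turanKernelSum
    rw [Complex.add_re, Complex.neg_re, re_sum_zetaZerosBelow_eq Z hZ hline hall _ (turanSummand_conj y)]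
    refine congrArg (-(1 / riemannZeta (1 / 2)).re + ·) ?_
    refine hsplit (fun γ' ↦ 2 * (kL ((1 / 2 : ℂ) + γ' * I).im * cexp (I * (((1 / 2 : ℂ) + γ' * I).im * y)) *
      (riemannZeta (2 * (1 / 2 + γ' * I)) / ((1 / 2 + γ' * I - 1) * deriv riemannZeta (1 / 2 + γ' * I)))).re) ?_ |>.trans ?_
    · intro j hj1 hj2
      have him : ((1 / 2 : ℂ) + (γ j : ℂ) * I).im = γ j := by simp
      rw [him, hkL_zero j hj1 hj2]; simp
    · refine Finset.sum_congr rfl fun k _ ↦ Finset.sum_congr rfl fun i _ ↦ ?_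
      have him : ((1 / 2 : ℂ) + (γ (k * CHUNK + i) : ℂ) * I).im = γ (k * CHUNK + i) := by simp
      rw [him]; rfl
  -- the block bounds
  have hbounds : ∀ k < NCHUNKL,
      ((chunkBounds.getD k (0, 0)).1 : ℝ) / 2 ^ 60 ≤ ∑ i ∈ Finset.range (chunkLen k), termP yL (γ (k * CHUNK + i)) ∧
      ∑ i ∈ Finset.range (chunkLen k), termT yT (γ (k * CHUNK + i)) ≤ ((chunkBounds.getD k (0, 0)).2 : ℝ) / 2 ^ 60 := by
    intro k hk
    have hidx : ∀ i < chunkLen k, k * CHUNK + i < NZL := by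
      intro i hi
      unfold chunkLen at hi
      have := lt_min_iff.1 hi
      omega
    refine checkChunk_sound' (hCh k hk) (fun i hi ↦ hsmall _ (hidx i hi)) γ fun i hi ↦ (hγ _ ?_).1
    exact (hidx i hi).trans hNZL
  have hplus : 0 < (polyaKernelSum kL heightT0 yL).re := by
    rw [hsumP]
    refine hFL.trans_le ?_
    unfold sumL
    push_cast
    rw [Finset.sum_div]
    gcongr with k hk
    exact (hbounds k (Finset.mem_range.1 hk)).1
  have hminus : (turanKernelSum kL heightT0 yT).re < 0 := by
    rw [hsumT]
    refine lt_of_le_of_lt ?_ hFU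
    unfold sumU
    push_cast
    rw [Finset.sum_div]
    gcongr with k hk
    exact (hbounds k (Finset.mem_range.1 hk)).2
  exact ⟨hclause, hplus, hminus⟩

end Soundness

/-! The checks are evaluated only by `native_decide` (block files); make them opaque to the
elaborator so that stating `checkChunk k = true` never unfolds the computation. -/
attribute [irreducible] checkChunk checkFinal

end Literature.NumberTheory.LFunctions.ZetaNumerics.Liouville
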